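import Literature.AnabelianGeometry.SemiGraphs.UniversalCoveringOver
import HarnessLib

/-!
# `𝒢_{∞,S} → 𝒢` is tempered whenever `S` is split by a finite covering ([SemiAnbd] §3 p. 38)

Proof-only complement to `UniversalCoveringOverProofs.lean` (which treats self-splitting `S`).
[SemiAnbd] p. 38: "the `𝒢_{∞,i} → 𝒢` are tempered coverings of `𝒢`".  In the presentation of
`TemperedCoverings.lean`: `Π_v` acts on a point `(V, x, p)` of `𝒢_{∞,S}` through `x ∈ S_v`, so any
covering `F` splitting `S` (Def. 3.5 (ii): the stabilisers of the points of `F` act trivially on the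
fibres of `S`) splits `𝒢_{∞,S}`; hence `𝒢_{∞,S}` is tempered as soon as `S` is split by a finite
covering with nonempty fibres — in particular for EVERY finite `S` when `𝒢` is Galois-countable
([IUTchI] Rmk. 2.5.3 (i) (T2): every finite étale covering is split by a member of the countable
family).
-/

namespace Literature.AnabelianGeometry.SemiGraphs

namespace ProfiniteSemiGraph

universe u

variable {𝒢 : ProfiniteSemiGraph.{u}} (F S : CovObj 𝒢) (c : S.orbitGraph.CatCarrier)
  (h𝒢 : 𝒢.IsCountable)

/-- A covering splitting `S` splits `𝒢_{∞,S}`. [cite: MochizukiSemiAnbd2006, Prop 3.6 p.38] -/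
theorem CovObj.splits_univCoverOver_of_splits (hsplit : F.Splits S) :
    F.Splits (S.univCoverOver c h𝒢) := by
  refine ⟨fun v x g hg t => ?_, fun e x g hg t => ?_⟩
  · exact CovObj.FibV.ext S c rfl (hsplit.1 v x g hg t.2.1.1) HEq.rfl
  · exact CovObj.FibE.ext S c rfl (hsplit.2 e x g hg t.2.1.1) HEq.rfl

/-- **`𝒢_{∞,S} → 𝒢` is tempered** when some finite covering with nonempty fibres splits `S`.
[cite: MochizukiSemiAnbd2006, Prop 3.6 p.38] -/
theorem CovObj.univCoverOver_isTempered_of_splits (hF : F.IsFinite) (hN : F.HasNonemptyFibres)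
    (hsplit : F.Splits S) : (S.univCoverOver c h𝒢).IsTempered := by
  intro p
  refine ⟨F, hF, hN, fun q _ => ?_⟩
  rcases q with ⟨v, t⟩ | ⟨e, t⟩
  · intro x g hg
    exact (CovObj.splits_univCoverOver_of_splits F S c h𝒢 hsplit).1 v x g hg t
  · intro x g hg
    exact (CovObj.splits_univCoverOver_of_splits F S c h𝒢 hsplit).2 e x g hg t

/-- **For Galois-countable `𝒢`, `𝒢_{∞,S} → 𝒢` is tempered for every finite `S`** (a member of the
countable family of [IUTchI] Rmk. 2.5.3 (i) (T2) splits `S`).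
[cite: MochizukiSemiAnbd2006, Prop 3.6 p.38] -/
theorem CovObj.univCoverOver_isTempered_of_isGaloisCountable (h : 𝒢.IsGaloisCountable)
    (hS : S.IsFinite) : (S.univCoverOver c h𝒢).IsTempered := by
  obtain ⟨Fam, hFam, hcof⟩ := h.2
  obtain ⟨i, hi⟩ := hcof S hS
  exact CovObj.univCoverOver_isTempered_of_splits (Fam i) S c h𝒢 (hFam i).1 (hFam i).2 hi

end ProfiniteSemiGraph

end Literature.AnabelianGeometry.SemiGraphs
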